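import Mathlib.Algebra.Order.BigOperators.Group.Finset
import Mathlib.Algebra.BigOperators.Ring.Finset
import Mathlib.Tactic.Ring
import Mathlib.Tactic.Linarith
import Literature.Computability.Complexity.GraphCanonizationParts
import HarnessLib

/-!
# A potential for the Corneil–Goldberg recursion: non-increasing along the recursion, dropping at big branchings

The amortisation behind the `C^k` bound on the section/individualization canoniser
(`GraphCanonizationScheme.lean`, `GraphCanonizationSchemeSize.lean`). Corneil–Goldberg
[CorneilGoldberg1984] and Laubner [Laubner2011, §3.5] bound the recursion tree by a counting
argument over "levels of large out-degree" that assumes no section occurs; here that count is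
replaced by a POTENTIAL which handles sections uniformly. Fix the scale `q ≥ 1`; a cell `Z` of a
state `(W, c)` is LARGE if `q |Z| > k`. With the per-cell term
`τ(s) = 3 q s - min (q s) k` (monotone and superadditive in `s`, `tau_mono`, `tau_superadd`)
the potential is

  `Θ_q(W, c) = ∑_{cells Z} τ(|Z|)`      (`CGCanon.theta`; `≤ 3 q |W|`, `theta_le`).

* `theta_mono_subset` — restricting the state to a subset does not increase `Θ` (τ monotone);
* `theta_mono_refines` — refining the colouring does not increase `Θ` (τ superadditive);
* `theta_drop` — **the drop**: if `K ⊆ W`, `c'` refines `c` on `W`, every `c'`-cell of `K` is large,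
  and EITHER at least `k / (2q)` vertices are discarded (`2 q |W ∖ K| ≥ k`) OR some `c`-cell holds
  two `c'`-cells of `K`, then `Θ_q(K, c') + k ≤ Θ_q(W, c)`;
* `exists_split_of_small_discard` — **the structural core**: in an equitable connected state,
  if `K ⊂ W` is reached through sections (every vertex of `W ∖ K` is homogeneous to every
  `c'`-cell of `K`), all `c'`-cells of `K` are large and `2 q |W ∖ K| < k`, then some `c`-cell
  holds two `c'`-cells of `K` — by connectivity an edge of the switched graph enters `K`, its
  outer end is switched-adjacent to a whole large `c'`-cell `C ⊆ Z`, so `2 |C| ≤ |Z|`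
  (half-degrees, `IsEqui.two_mul_card_filter_adj_le`) while `|Z ∩ K| ≥ |Z| - |W ∖ K| > |C|`.

Consequence (in `GraphCanonizationSchemeSize.lean`): along every chain of branching states the
number of branchings of degree `> k / q` is `O(q)`, whence the product of the degrees is `2^{O(k)}`.

## References

* D. G. Corneil, M. K. Goldberg, J. Algorithms 5 (1984) 345–362, §4 (the `cⁿ` bound). [CorneilGoldberg1984]
* B. Laubner, PhD thesis, HU Berlin 2011, doi:10.18452/16335, §3.5 (Lemma 3.5.1, Prop. 3.5.2). [Laubner2011]
-/

namespace Literature.Computability.Complexity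

open Literature.Combinatorics.SimpleGraph Finset

open scoped Classical

noncomputable section

namespace CGCanon

variable {k : ℕ}

/-! ### Cells by colour value and the per-cell term -/

/-- The vertices of `W` of colour `a`. [folklore] -/
def cls (W : Finset (Fin k)) (c : Fin k → ℕ) (a : ℕ) : Finset (Fin k) := W.filter fun v => c v = a

/-- Membership. [folklore] -/
@[simp] theorem mem_cls {W : Finset (Fin k)} {c : Fin k → ℕ} {a : ℕ} {v : Fin k} : v ∈ cls W c a ↔ v ∈ W ∧ c v = a := mem_filter

/-- The cell of a vertex is the class of its colour. [folklore] -/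
theorem cls_eq_cell (W : Finset (Fin k)) (c : Fin k → ℕ) (v : Fin k) : cls W c (c v) = cell W c v := rfl

/-- The classes partition `W`: their sizes add up to `|W|`. [folklore] -/
theorem sum_card_cls (W : Finset (Fin k)) (c : Fin k → ℕ) : ∑ a ∈ W.image c, (cls W c a).card = W.card :=
  (card_eq_sum_card_image c W).symm

/-- The per-cell term `τ(s) = 3 q s - min (q s) k`. [folklore] -/
def tau (k q s : ℕ) : ℕ := 3 * q * s - min (q * s) k

/-- `τ(s) + min (q s) k = 3 q s`. [folklore] -/
theorem tau_add_min (k q s : ℕ) : tau k q s + min (q * s) k = 3 * q * s := by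
  unfold tau
  have : min (q * s) k ≤ 3 * q * s := (min_le_left _ _).trans (by nlinarith)
  omega

/-- `τ(0) = 0`. [folklore] -/
@[simp] theorem tau_zero (k q : ℕ) : tau k q 0 = 0 := by simp [tau]

/-- `τ` is monotone. [folklore] -/
theorem tau_mono (k q : ℕ) {s s' : ℕ} (h : s ≤ s') : tau k q s ≤ tau k q s' := by
  have h1 := tau_add_min k q s
  have h2 := tau_add_min k q s'
  have h3 : q * s ≤ q * s' := Nat.mul_le_mul_left q h
  have h4 : min (q * s') k ≤ min (q * s) k + (q * s' - q * s) := by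
    rcases le_total (q * s) k with h5 | h5
    · rw [min_eq_left h5]; exact (min_le_left _ _).trans (by omega)
    · rw [min_eq_right h5, min_eq_right (h5.trans h3)]; omega
  rw [mul_assoc] at h1 h2
  have key : ∀ A B tA tB mA mB : ℕ, tA + mA = 3 * A → tB + mB = 3 * B → A ≤ B → mB ≤ mA + (B - A) → tA ≤ tB := by
    intros; omega
  exact key _ _ _ _ _ _ h1 h2 h3 h4

/-- `τ` is superadditive (`min` is subadditive). [folklore] -/
theorem tau_superadd (k q a b : ℕ) : tau k q a + tau k q b ≤ tau k q (a + b) := by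
  have h1 := tau_add_min k q a
  have h2 := tau_add_min k q b
  have h3 := tau_add_min k q (a + b)
  have h4 : min (q * (a + b)) k ≤ min (q * a) k + min (q * b) k := by
    rw [Nat.mul_add]
    rcases le_total (q * a) k with ha | ha <;> rcases le_total (q * b) k with hb | hb <;>
      simp only [min_eq_left, min_eq_right, ha, hb] <;> omega
  rw [mul_assoc] at h1 h2 h3
  rw [Nat.mul_add] at h3 h4
  have key : ∀ A B tA tB tAB mA mB mAB : ℕ, tA + mA = 3 * A → tB + mB = 3 * B → tAB + mAB = 3 * (A + B) →
      mAB ≤ mA + mB → tA + tB ≤ tAB := by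
    intros; omega
  exact key _ _ _ _ _ _ _ _ h1 h2 h3 h4

/-- On a large cell `τ(s) = 3 q s - k`, i.e. `τ(s) + k = 3 q s`. [folklore] -/
theorem tau_add_of_large {k q s : ℕ} (h : k < q * s) : tau k q s + k = 3 * q * s := by
  have := tau_add_min k q s
  rwa [min_eq_right h.le] at this

/-- A superadditive function with `f 0 = 0` is superadditive over finite sums. [folklore] -/
theorem sum_le_of_superadd {ι : Type} (f : ℕ → ℕ) (h0 : f 0 = 0) (hf : ∀ a b, f a + f b ≤ f (a + b)) (s : Finset ι) (g : ι → ℕ) :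
    ∑ i ∈ s, f (g i) ≤ f (∑ i ∈ s, g i) := by
  induction s using Finset.induction_on with
  | empty => simp [h0]
  | insert a s ha ih =>
    rw [sum_insert ha, sum_insert ha]
    exact (Nat.add_le_add_left ih _).trans (hf _ _)

/-! ### The potential -/

/-- **The potential** `Θ_q(W, c) = ∑_{cells Z of (W, c)} τ(|Z|)`. [folklore] -/
def theta (q : ℕ) (W : Finset (Fin k)) (c : Fin k → ℕ) : ℕ := ∑ a ∈ W.image c, tau k q (cls W c a).card

/-- `Θ_q(W, c) + ∑_{cells} min (q |Z|) k = 3 q |W|`. [folklore] -/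
theorem theta_add_sum_min (q : ℕ) (W : Finset (Fin k)) (c : Fin k → ℕ) :
    theta q W c + ∑ a ∈ W.image c, min (q * (cls W c a).card) k = 3 * q * W.card := by
  unfold theta
  rw [← sum_add_distrib, sum_congr rfl fun a _ => tau_add_min k q _, ← mul_sum, sum_card_cls]

/-- `Θ_q(W, c) ≤ 3 q |W|`. [folklore] -/
theorem theta_le (q : ℕ) (W : Finset (Fin k)) (c : Fin k → ℕ) : theta q W c ≤ 3 * q * W.card := by
  have := theta_add_sum_min q W c; omega

/-- **Monotonicity under restriction**: `K ⊆ W ⇒ Θ_q(K, c) ≤ Θ_q(W, c)`. [folklore] -/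
theorem theta_mono_subset (q : ℕ) {K W : Finset (Fin k)} (hKW : K ⊆ W) (c : Fin k → ℕ) : theta q K c ≤ theta q W c := by
  unfold theta
  calc ∑ a ∈ K.image c, tau k q (cls K c a).card ≤ ∑ a ∈ K.image c, tau k q (cls W c a).card :=
        sum_le_sum fun a _ => tau_mono k q (card_le_card (filter_subset_filter _ hKW))
    _ ≤ ∑ a ∈ W.image c, tau k q (cls W c a).card :=
        sum_le_sum_of_subset_of_nonneg (image_subset_image hKW) fun _ _ _ => Nat.zero_le _

/-- **Monotonicity under refinement**: if `c'` refines `c` on `W` then `Θ_q(W, c') ≤ Θ_q(W, c)`. [folklore] -/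
theorem theta_mono_refines (q : ℕ) {W : Finset (Fin k)} {c c' : Fin k → ℕ}
    (h : ∀ ⦃u v : Fin k⦄, u ∈ W → v ∈ W → c' u = c' v → c u = c v) : theta q W c' ≤ theta q W c := by
  unfold theta
  -- group the `c'`-classes by the `c`-class containing them
  set fib : ℕ → Finset ℕ := fun a => (W.image c').filter fun b => ∃ v ∈ W, c' v = b ∧ c v = a with hfib
  have hcover : W.image c' = (W.image c).biUnion fib := by
    ext b
    simp only [mem_biUnion, mem_image, hfib, mem_filter]
    constructor
    · rintro ⟨v, hv, rfl⟩
      exact ⟨c v, ⟨v, hv, rfl⟩, ⟨v, hv, rfl⟩, v, hv, rfl, rfl⟩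
    · rintro ⟨a, -, h1, -⟩
      exact h1
  have hdisj : ((W.image c : Finset ℕ) : Set ℕ).PairwiseDisjoint fib := by
    intro a _ a' _ hne
    rw [Function.onFun, disjoint_left]
    rintro b hb hb'
    simp only [hfib, mem_filter] at hb hb'
    obtain ⟨-, v, hv, hvb, hva⟩ := hb
    obtain ⟨-, v', hv', hv'b, hv'a⟩ := hb'
    exact hne (hva ▸ hv'a ▸ h hv hv' (hvb.trans hv'b.symm))
  rw [hcover, sum_biUnion hdisj]
  refine sum_le_sum fun a ha => ?_
  -- within one `c`-class: superadditivity, the sub-classes partitioning the class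
  refine (sum_le_of_superadd (tau k q) (tau_zero k q) (tau_superadd k q) (fib a) fun b => (cls W c' b).card).trans
    (tau_mono k q (le_of_eq ?_))
  rw [cls, card_eq_sum_card_image c' (W.filter fun v => c v = a)]
  refine sum_congr ?_ fun b hb => ?_
  · ext b
    simp only [hfib, mem_filter, mem_image]
    constructor
    · rintro ⟨-, v, hv, rfl, hva⟩
      exact ⟨v, ⟨hv, hva⟩, rfl⟩
    · rintro ⟨v, ⟨hv, hva⟩, rfl⟩
      exact ⟨⟨v, hv, rfl⟩, v, hv, rfl, hva⟩
  · obtain ⟨v, hv, hvb⟩ := mem_image.1 hb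
    rw [mem_filter] at hv
    obtain ⟨hv, hva⟩ := hv
    congr 1
    ext w
    simp only [cls, mem_filter]
    constructor
    · rintro ⟨hw, hwb⟩
      exact ⟨⟨hw, hva ▸ h hw hv (hwb.trans hvb.symm)⟩, hwb⟩
    · rintro ⟨⟨hw, -⟩, hwb⟩
      exact ⟨hw, hwb⟩

/-! ### The drop -/

/-- If every `c'`-class of `K` is large, `Θ_q(K, c') + k · #classes = 3 q |K|`. [folklore] -/
theorem theta_add_of_large {q : ℕ} {K : Finset (Fin k)} {c' : Fin k → ℕ} (hlarge : ∀ v ∈ K, k < q * (cls K c' (c' v)).card) :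
    theta q K c' + k * (K.image c').card = 3 * q * K.card := by
  unfold theta
  rw [card_eq_sum_ones (K.image c'), mul_sum, mul_one, ← sum_add_distrib, ← sum_card_cls K c', mul_sum]
  refine sum_congr rfl fun b hb => ?_
  obtain ⟨v, hv, rfl⟩ := mem_image.1 hb
  exact tau_add_of_large (hlarge v hv)

/-- The colours of `c` present on `K` number at most the `c'`-classes of `K` (when `c'` refines `c`),
and strictly fewer if some `c`-class holds two `c'`-classes of `K`. [folklore] -/
theorem card_image_le_of_refines' {K : Finset (Fin k)} {c c' : Fin k → ℕ}
    (h : ∀ ⦃u v : Fin k⦄, u ∈ K → v ∈ K → c' u = c' v → c u = c v) :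
    (K.image c).card ≤ (K.image c').card ∧
      ((∃ v ∈ K, ∃ w ∈ K, c v = c w ∧ c' v ≠ c' w) → (K.image c).card < (K.image c').card) := by
  let T : Finset (ℕ × ℕ) := K.image fun v => (c' v, c v)
  have h1 : K.image c' = T.image Prod.fst := by rw [image_image]; rfl
  have h2 : K.image c = T.image Prod.snd := by rw [image_image]; rfl
  have hinj : Set.InjOn Prod.fst (T : Set (ℕ × ℕ)) := by
    rintro ⟨a, b⟩ hab ⟨a', b'⟩ hab' (haa : a = a')
    obtain ⟨v, hv, hve⟩ := mem_image.1 (mem_coe.1 hab)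
    obtain ⟨v', hv', hve'⟩ := mem_image.1 (mem_coe.1 hab')
    simp only [Prod.mk.injEq] at hve hve'
    obtain ⟨rfl, rfl⟩ := hve
    obtain ⟨rfl, rfl⟩ := hve'
    exact Prod.ext haa (h hv hv' haa)
  have hT : (K.image c').card = T.card := by rw [h1, card_image_of_injOn hinj]
  refine ⟨by rw [hT, h2]; exact card_image_le, fun ⟨v, hv, w, hw, hcw, hne⟩ => ?_⟩
  rw [hT, h2]
  refine lt_of_le_of_ne card_image_le fun heq => hne ?_
  have hinj2 : Set.InjOn Prod.snd (T : Set (ℕ × ℕ)) := card_image_iff.1 heq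
  have := hinj2 (mem_coe.2 (mem_image_of_mem _ hv)) (mem_coe.2 (mem_image_of_mem _ hw)) hcw
  exact (Prod.ext_iff.1 this).1

/-- **The drop.** Let `K ⊆ W`, `c'` refine `c` on `W`, every `c'`-class of `K` be large, and
suppose EITHER `2 q |W ∖ K| ≥ k` OR some `c`-class holds two `c'`-classes of `K`. Then
`Θ_q(K, c') + k ≤ Θ_q(W, c)`. [folklore] -/
theorem theta_drop {q : ℕ} {K W : Finset (Fin k)} (hKW : K ⊆ W) {c c' : Fin k → ℕ}
    (href : ∀ ⦃u v : Fin k⦄, u ∈ W → v ∈ W → c' u = c' v → c u = c v)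
    (hlarge : ∀ v ∈ K, k < q * (cls K c' (c' v)).card)
    (hsplit : k ≤ 2 * q * (W \ K).card ∨ ∃ v ∈ K, ∃ w ∈ K, c v = c w ∧ c' v ≠ c' w) :
    theta q K c' + k ≤ theta q W c := by
  have hP1 := theta_add_of_large hlarge
  have hP2 := theta_add_sum_min q W c
  -- `∑_{c-cells of W} min (q |Z|) k ≤ k · #(colours of c on K) + q |W \ K|`
  have hmin : ∑ a ∈ W.image c, min (q * (cls W c a).card) k ≤ k * (K.image c).card + q * (W \ K).card := by
    have hsplitsum : ∑ a ∈ W.image c, min (q * (cls W c a).card) k =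
        ∑ a ∈ K.image c, min (q * (cls W c a).card) k + ∑ a ∈ W.image c \ K.image c, min (q * (cls W c a).card) k := by
      rw [← sum_union disjoint_sdiff, union_sdiff_of_subset (image_subset_image hKW)]
    rw [hsplitsum]
    refine Nat.add_le_add ?_ ?_
    · calc ∑ a ∈ K.image c, min (q * (cls W c a).card) k ≤ ∑ a ∈ K.image c, k := sum_le_sum fun _ _ => min_le_right _ _
        _ = k * (K.image c).card := by rw [sum_const, smul_eq_mul, Nat.mul_comm]
    · calc ∑ a ∈ W.image c \ K.image c, min (q * (cls W c a).card) k
          ≤ ∑ a ∈ W.image c \ K.image c, q * (cls W c a).card := sum_le_sum fun _ _ => min_le_left _ _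
        _ = q * ∑ a ∈ W.image c \ K.image c, (cls W c a).card := by rw [mul_sum]
        _ ≤ q * (W \ K).card := Nat.mul_le_mul_left q ?_
      -- classes of colours absent from `K` lie in `W \ K`, disjointly
      rw [← card_biUnion]
      · refine card_le_card fun v hv => ?_
        simp only [mem_biUnion, mem_sdiff, mem_image, mem_cls] at hv ⊢
        obtain ⟨a, ⟨-, hna⟩, hvW, hva⟩ := hv
        exact ⟨hvW, fun hvK => hna ⟨v, hvK, hva⟩⟩
      · intro a _ a' _ hne
        rw [Function.onFun, disjoint_left]
        intro v hv hv'
        rw [mem_cls] at hv hv'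
        exact hne (hv.2.symm.trans hv'.2)
  obtain ⟨hNM, hstrict⟩ := card_image_le_of_refines' (K := K) fun u v hu hv => href (hKW hu) (hKW hv)
  have hcardW : W.card = K.card + (W \ K).card := by rw [← card_union_of_disjoint disjoint_sdiff, union_sdiff_of_subset hKW]
  have hk1 : k * (K.image c).card ≤ k * (K.image c').card := Nat.mul_le_mul_left k hNM
  rcases hsplit with hD | hsp
  · nlinarith [hP1, hP2, hmin, hk1, hcardW, hD]
  · have hk2 : k * ((K.image c).card + 1) ≤ k * (K.image c').card := Nat.mul_le_mul_left k (hstrict hsp)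
    nlinarith [hP1, hP2, hmin, hk2, hcardW]

/-! ### The structural core: a split class after a small discard -/

variable {G : SimpleGraph (Fin k)} {W K : Finset (Fin k)} {c c' : Fin k → ℕ}

/-- **A split class after a small discard.** Let `(W, c)` be an equitable connected state, `c'` a
refinement of `c` on `W`, `x ∈ W ∖ K`, `K ⊆ W` nonempty, every vertex of `W ∖ K` homogeneous to
every `c'`-class of `K`, every `c'`-class of `K` large (`q |C| > k`) and `2 q |W ∖ K| < k`. Then some
`c`-class holds two `c'`-classes of `K`. [folklore] -/
theorem exists_split_of_small_discard {q : ℕ} (hE : IsEqui G W c) (hconn : IsConn G W c)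
    (href : ∀ ⦃u v : Fin k⦄, u ∈ W → v ∈ W → c' u = c' v → c u = c v)
    (hKW : K ⊆ W) (hK : K.Nonempty) {x : Fin k} (hxW : x ∈ W) (hxK : x ∉ K)
    (hhom : ∀ u ∈ W, u ∉ K → ∀ v ∈ K, ∀ w ∈ K, c' v = c' w → (G.Adj u v ↔ G.Adj u w))
    (hlarge : ∀ v ∈ K, k < q * (cls K c' (c' v)).card) (hsmall : 2 * q * (W \ K).card < k) :
    ∃ v ∈ K, ∃ w ∈ K, c v = c w ∧ c' v ≠ c' w := by
  -- an edge of the switched graph entering `K`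
  obtain ⟨v₀, hv₀⟩ := hK
  obtain ⟨p⟩ := hconn hxW (hKW hv₀)
  obtain ⟨d, -, hdu, hdv⟩ := p.exists_boundary_dart ((K : Set (Fin k))ᶜ) (by simpa using hxK) (by simpa using hv₀)
  set u := d.fst
  set v := d.snd
  have huv : (swG G W c).Adj u v := d.adj
  have huK : u ∉ K := by simpa using hdu
  have hvK : v ∈ K := by simpa using hdv
  have huW : u ∈ W := (swG_mem huv).1
  have hvW : v ∈ W := hKW hvK
  -- `u` is switched-adjacent to the whole `c'`-class `C` of `v` in `K`, which lies in the `c`-cell `Z` of `v`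
  set C := cls K c' (c' v) with hC
  have hCsub : C ⊆ (cell W c v).filter fun w => (swG G W c).Adj u w := by
    intro w hw
    rw [mem_cls] at hw
    have hwW : w ∈ W := hKW hw.1
    have hcw : c w = c v := href hwW hvW hw.2
    refine mem_filter.2 ⟨mem_cell.2 ⟨hwW, hcw⟩, ?_⟩
    rw [swG_adj_iff huW hwW]
    rw [swG_adj_iff huW hvW] at huv
    refine ⟨fun e => huK (e ▸ hw.1), ?_⟩
    rw [liftCol_of_mem c hwW, hcw, ← liftCol_of_mem c hvW, hhom u huW huK w hw.1 v hvK hw.2]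
    exact huv.2
  have h2C : 2 * C.card ≤ (cell W c v).card := (Nat.mul_le_mul_left 2 (card_le_card hCsub)).trans (hE.two_mul_card_filter_adj_le u hvW)
  -- sizes: `|C| > 2 |W \ K|`, so `|Z ∩ K| ≥ |Z| - |W \ K| > |C|`
  have hCbig : 2 * (W \ K).card < C.card := by
    have h1 := hlarge v hvK
    rw [← hC] at h1
    have hqpos : 0 < q := Nat.pos_of_ne_zero fun hq0 => by rw [hq0, Nat.zero_mul] at h1; exact Nat.not_lt_zero _ h1
    nlinarith
  have hZK : (cell W c v).card ≤ ((cell W c v).filter fun w => w ∈ K).card + (W \ K).card := by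
    calc (cell W c v).card = ((cell W c v).filter fun w => w ∈ K).card + ((cell W c v).filter fun w => w ∉ K).card :=
          (card_filter_add_card_filter_not _).symm
      _ ≤ ((cell W c v).filter fun w => w ∈ K).card + (W \ K).card :=
          Nat.add_le_add_left (card_le_card fun w hw => by
            rw [mem_filter, mem_cell] at hw; exact mem_sdiff.2 ⟨hw.1.1, hw.2⟩) _
  have hlt : C.card < ((cell W c v).filter fun w => w ∈ K).card := by omega
  -- a vertex of `Z ∩ K` outside `C`
  obtain ⟨w, hw, hwC⟩ := exists_mem_notMem_of_card_lt_card hlt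
  rw [mem_filter, mem_cell] at hw
  refine ⟨v, hvK, w, hw.2, hw.1.2.symm, fun h => hwC ?_⟩
  rw [hC, mem_cls]
  exact ⟨hw.2, h.symm⟩

end CGCanon

end

end Literature.Computability.Complexity
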